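import Mathlib.AlgebraicGeometry.Morphisms.Preimmersion
import Mathlib.AlgebraicGeometry.PullbackCarrier
import Mathlib.RingTheory.Localization.AtPrime.Basic
import Mathlib.Order.KrullDimension
import Literature.AlgebraicGeometry.Resolution.Lipman1969RationalSurfaceSingularities
import HarnessLib

/-!
# Crux `NoZenoR` (stmt-ResolutionOfSingularities-19943), slot `stub_L1wCoreF`, (B1) split core, assembly seam (A1):
# the integral exceptional curves of a resolution base-changed to a LOCAL RING OF THE BASE

Route `ResolutionOfSingularities/HomologicalConductor`.  OURS (cell res-hironaka, crux chain W4.4, lead seat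
res-L0-w44-lead-1 g8, memo `B1-CENSUS-g8.md` §2 (A1)); nothing here is a statement of the manuscript under review
(Hironaka 2017); AI-written, weaker than expert review.

In the (B1) split core the chart resolution `σ : V → Spec N` (`N = nrm k[S ∪ I·x⁻¹]`, tree
`SurfaceTermination.ChartResolution.exists_isResolution_chartMorphism`) is base-changed to the germ `N_𝔮` of a CLOSED point
`𝔮` (`…ChartResolutionBirational.isResolution_pullback_snd_of_isLocalization`); the assembly must identify the integral
exceptional curves of `σ_𝔮 : V ×_N Spec N_𝔮 → Spec N_𝔮` with the curves of `V` lying over `𝔮`.  Companion of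
res-L0-w44-stub-2's BC-2a `excCurvePoints_pullback_snd` (finite base change, `…NoZenoExcCurvesBaseChange`): here the base
change is a PREIMMERSION (e.g. `Spec` of a localisation), injective over a closed point.

* `exists_ltSeries_last_eq_of_isEmbedding`, `height_apply_eq_of_isEmbedding` — for an embedding `φ : Z → X` whose range
  contains every specialisation of `φ z`, `height (φ z) = height z` (chains of specialisations lift);
* `excCurvePoints_pullback_snd_of_isPreimmersion` — for `σ : V → Spec N`, `g : Spec N′ → Spec N` a preimmersion (`N′`
  local) with `q := g(𝔪_{N′})` CLOSED in `Spec N` and `g⁻¹ q = {𝔪_{N′}}`: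
  `excCurvePoints (pullback.snd σ g) = (pullback.fst σ g)⁻¹ {z | σ z = q ∧ height z = 1}`, with
  `image_excCurvePoints_pullback_snd_of_isPreimmersion` (the first projection maps them injectively ONTO that set) and
  finiteness transfer;
* `excCurvePoints_pullback_snd_localization` — the case `g = Spec (N → N_𝔮)`, `𝔮` maximal:
  `excCurvePoints σ_𝔮 = fst⁻¹ {z | σ z = 𝔮 ∧ height z = 1}`.

References: The Stacks Project, Tag 01JT (points of a fibre product along a monomorphism), Tag 02ND (specialisation)
[`StacksProject`]; res-L0-w44-stub-2, (L1)-PREP v2/v3 (OURS, 2026-08-27).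
-/

noncomputable section

-- single-problem summit: the doubled namespace component `ResolutionOfSingularities` is forced
set_option linter.dupNamespace false

namespace Summit.ResolutionOfSingularities.ResolutionOfSingularities.Theorems.NoZeno.ExcCount

open CategoryTheory CategoryTheory.Limits AlgebraicGeometry TopologicalSpace Topology IsLocalRing
open Literature.AlgebraicGeometry.Resolution

universe u

/-! ## Heights along an embedding with specialisation-closed range -/

section Embedding

variable {X Z : Scheme.{u}} (φ : Z ⟶ X)

/-- **An embedding lifts chains of proper specialisations inside its range**: if `φ : Z → X` is a topological
embedding and every specialisation of `φ z` lies in the range of `φ`, every chain `x₀ < x₁ < ⋯ < xₙ = φ z` of the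
specialisation order of `X` (`xₙ ⤳ xₙ₋₁ ⤳ ⋯`) lifts to a chain of the same length in `Z` ending at `z`. [folklore] -/
theorem exists_ltSeries_last_eq_of_isEmbedding (hφ : IsEmbedding φ.base) :
    ∀ (n : ℕ) (p : LTSeries X) (z : Z), (∀ x : X, φ.base z ⤳ x → x ∈ Set.range φ.base) →
      p.last = φ.base z → p.length = n → ∃ q : LTSeries Z, q.last = z ∧ q.length = n := by
  intro n
  induction n with
  | zero =>
    intro p z _ _ _
    exact ⟨RelSeries.singleton _ z, by simp, by simp⟩
  | succ n ih =>
    intro p z hrange hlast hlen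
    have hne : p.length ≠ 0 := by omega
    have hrel : p.eraseLast.last < p.last := p.eraseLast_last_rel_last hne
    rw [hlast] at hrel
    have hspec : φ.base z ⤳ p.eraseLast.last := (Scheme.le_iff_specializes).mp hrel.le
    obtain ⟨z', hz'eq⟩ := hrange _ hspec
    have hzz' : z ⤳ z' := hφ.isInducing.specializes_iff.mp (hz'eq ▸ hspec)
    have hrange' : ∀ x : X, φ.base z' ⤳ x → x ∈ Set.range φ.base :=
      fun x hx => hrange x (hspec.trans (hz'eq ▸ hx))
    obtain ⟨q', hq'last, hq'len⟩ := ih p.eraseLast z' hrange' hz'eq.symm (by simp [hlen])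
    have hlt : q'.last < z := by
      rw [hq'last, lt_iff_le_not_ge, Scheme.le_iff_specializes, Scheme.le_iff_specializes]
      refine ⟨hzz', fun h => hrel.not_ge ?_⟩
      rw [Scheme.le_iff_specializes, ← hz'eq]
      exact h.map φ.continuous
    exact ⟨q'.snoc z hlt, by simp, by simp [hq'len]⟩

/-- An embedding is strictly monotone for the specialisation orders (it is injective and reflects specialisation).
[folklore] -/
theorem strictMono_of_isEmbedding (hφ : IsEmbedding φ.base) : StrictMono φ.base := by
  intro a b hab
  rw [lt_iff_le_not_ge, Scheme.le_iff_specializes, Scheme.le_iff_specializes] at hab ⊢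
  exact ⟨hab.1.map φ.continuous, fun h => hab.2 (hφ.isInducing.specializes_iff.mp h)⟩

/-- **`height (φ z) = height z`** for an embedding `φ` whose range contains every specialisation of `φ z`. [folklore] -/
theorem height_apply_eq_of_isEmbedding (hφ : IsEmbedding φ.base) (z : Z)
    (hrange : ∀ x : X, φ.base z ⤳ x → x ∈ Set.range φ.base) :
    Order.height (φ.base z) = Order.height z := by
  refine le_antisymm (Order.height_le fun p hp => ?_)
    (Order.height_le_height_apply_of_strictMono _ (strictMono_of_isEmbedding φ hφ) z)
  obtain ⟨q, hqlast, hqlen⟩ := exists_ltSeries_last_eq_of_isEmbedding φ hφ p.length p z hrange hp rfl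
  have h := Order.length_le_height_last (p := q)
  rw [hqlast, hqlen] at h
  exact h

end Embedding

/-! ## Exceptional curves of the base change along a preimmersion injective over a closed point -/

section Preimmersion

variable {N N' : Type u} [CommRing N] [CommRing N'] [IsLocalRing N'] {V : Scheme.{u}}
  (σ : V ⟶ Spec (.of N)) (g : Spec (.of N') ⟶ Spec (.of N)) [IsPreimmersion g]
  (hq : IsClosed ({g.base (closedPoint N')} : Set (Spec (.of N))))
  (hg : g.base ⁻¹' {g.base (closedPoint N')} = {closedPoint N'})

omit [IsPreimmersion g] in
include hg in
/-- A point of `V ×_N Spec N′` lies over the closed point of `N′` iff its image in `V` lies over `q = g(𝔪_{N′})`.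
[folklore] -/
theorem snd_eq_closedPoint_iff (ζ : ↑(pullback σ g)) :
    (pullback.snd σ g).base ζ = closedPoint N' ↔ σ.base ((pullback.fst σ g).base ζ) = g.base (closedPoint N') := by
  have hcomp : σ.base ((pullback.fst σ g).base ζ) = g.base ((pullback.snd σ g).base ζ) := by
    change (pullback.fst σ g ≫ σ).base ζ = (pullback.snd σ g ≫ g).base ζ
    rw [pullback.condition]
  rw [hcomp]
  constructor
  · intro h; rw [h]
  · intro h
    have : (pullback.snd σ g).base ζ ∈ g.base ⁻¹' {g.base (closedPoint N')} := h
    rw [hg] at this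
    exact this

include hq hg in
/-- Over the closed point, the first projection preserves heights: the range of the embedding `pullback.fst` is
`σ⁻¹(range g)`, which contains every specialisation of a point over the CLOSED point `q`. [folklore] -/
theorem height_fst_eq (ζ : ↑(pullback σ g)) (hζ : (pullback.snd σ g).base ζ = closedPoint N') :
    Order.height ((pullback.fst σ g).base ζ) = Order.height ζ := by
  refine height_apply_eq_of_isEmbedding (pullback.fst σ g) (pullback.fst σ g).isEmbedding ζ fun x hx => ?_
  rw [Scheme.Pullback.range_fst]
  have hσz : σ.base ((pullback.fst σ g).base ζ) = g.base (closedPoint N') :=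
    (snd_eq_closedPoint_iff σ g hg ζ).mp hζ
  have hσx : g.base (closedPoint N') ⤳ σ.base x := hσz ▸ hx.map σ.continuous
  have hx' : σ.base x ∈ ({g.base (closedPoint N')} : Set (Spec (.of N))) := by
    rw [← hq.closure_eq]
    exact specializes_iff_mem_closure.mp hσx
  exact ⟨closedPoint N', (Set.mem_singleton_iff.mp hx').symm⟩

include hq hg in
/-- **`excCurvePoints (σ ×_N N′) = fst⁻¹ {z | σ z = q ∧ height z = 1}`** for a preimmersion `g : Spec N′ → Spec N`
injective over the closed point `q = g(𝔪_{N′})` of `Spec N`. [this work] -/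
theorem excCurvePoints_pullback_snd_of_isPreimmersion :
    excCurvePoints (pullback.snd σ g) =
      (pullback.fst σ g).base ⁻¹' {z | σ.base z = g.base (closedPoint N') ∧ Order.height z = 1} := by
  ext ζ
  simp only [excCurvePoints, Set.mem_setOf_eq, Set.mem_preimage]
  constructor
  · rintro ⟨h1, h2⟩
    exact ⟨(snd_eq_closedPoint_iff σ g hg ζ).mp h1, (height_fst_eq σ g hq hg ζ h1) ▸ h2⟩
  · rintro ⟨h1, h2⟩
    have h1' := (snd_eq_closedPoint_iff σ g hg ζ).mpr h1
    exact ⟨h1', (height_fst_eq σ g hq hg ζ h1').symm ▸ h2⟩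

include hq hg in
/-- The first projection maps the exceptional curves of `σ ×_N N′` ONTO the curves of `V` over `q`. [this work] -/
theorem image_excCurvePoints_pullback_snd_of_isPreimmersion :
    (pullback.fst σ g).base '' excCurvePoints (pullback.snd σ g) =
      {z | σ.base z = g.base (closedPoint N') ∧ Order.height z = 1} := by
  rw [excCurvePoints_pullback_snd_of_isPreimmersion σ g hq hg, Set.image_preimage_eq_inter_range,
    Set.inter_eq_left, Scheme.Pullback.range_fst]
  rintro z ⟨hz, -⟩
  exact ⟨closedPoint N', hz.symm⟩

/-- The first projection is injective on the exceptional curves (it is an embedding). [this work] -/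
theorem injOn_fst_excCurvePoints :
    Set.InjOn (pullback.fst σ g).base (excCurvePoints (pullback.snd σ g)) :=
  (pullback.fst σ g).isEmbedding.injective.injOn

include hq hg in
/-- Finiteness transfer: the exceptional curves of `σ ×_N N′` are finite iff the curves of `V` over `q` are. [this work] -/
theorem excCurvePoints_pullback_snd_finite_iff_of_isPreimmersion :
    (excCurvePoints (pullback.snd σ g)).Finite ↔
      {z | σ.base z = g.base (closedPoint N') ∧ Order.height z = 1}.Finite := by
  rw [← image_excCurvePoints_pullback_snd_of_isPreimmersion σ g hq hg]
  exact (Set.finite_image_iff (injOn_fst_excCurvePoints σ g)).symm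

end Preimmersion

/-! ## The case of a localisation at a maximal ideal -/

section Localization

variable {N N' : Type u} [CommRing N] [CommRing N'] [Algebra N N'] (𝔮 : Ideal N) [𝔮.IsMaximal]
  [IsLocalization.AtPrime N' 𝔮] {V : Scheme.{u}} (σ : V ⟶ Spec (.of N))

/-- `Spec N_𝔮 → Spec N` sends the closed point to `𝔮`. [folklore] -/
theorem specMap_localization_closedPoint :
    haveI := IsLocalization.AtPrime.isLocalRing N' 𝔮
    (Spec.map (CommRingCat.ofHom (algebraMap N N'))).base (closedPoint N') = ⟨𝔮, inferInstance⟩ := by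
  haveI := IsLocalization.AtPrime.isLocalRing N' 𝔮
  apply PrimeSpectrum.ext
  change (maximalIdeal N').comap (algebraMap N N') = 𝔮
  exact IsLocalization.AtPrime.under_maximalIdeal N' 𝔮

/-- **(A1) for the germ at a closed point**: for `σ : V → Spec N` and `𝔮` a maximal ideal of `N`, the integral
exceptional curves of `σ_𝔮 : V ×_N Spec N_𝔮 → Spec N_𝔮` are, via the first projection, exactly the height-one points
of `V` over `𝔮`. [this work] -/
theorem excCurvePoints_pullback_snd_localization :
    haveI := IsLocalization.AtPrime.isLocalRing N' 𝔮
    excCurvePoints (pullback.snd σ (Spec.map (CommRingCat.ofHom (algebraMap N N')))) =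
      (pullback.fst σ (Spec.map (CommRingCat.ofHom (algebraMap N N')))).base ⁻¹'
        {z | σ.base z = ⟨𝔮, inferInstance⟩ ∧ Order.height z = 1} := by
  haveI := IsLocalization.AtPrime.isLocalRing N' 𝔮
  haveI : IsPreimmersion (Spec.map (CommRingCat.ofHom (algebraMap N N'))) :=
    IsPreimmersion.of_isLocalization 𝔮.primeCompl
  have hq : IsClosed ({(Spec.map (CommRingCat.ofHom (algebraMap N N'))).base (closedPoint N')} :
      Set (Spec (.of N))) := by
    rw [specMap_localization_closedPoint 𝔮]
    exact (PrimeSpectrum.isClosed_singleton_iff_isMaximal _).mpr ‹𝔮.IsMaximal›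
  have hg : (Spec.map (CommRingCat.ofHom (algebraMap N N'))).base ⁻¹'
      {(Spec.map (CommRingCat.ofHom (algebraMap N N'))).base (closedPoint N')} = {closedPoint N'} := by
    ext y
    simp only [Set.mem_preimage, Set.mem_singleton_iff]
    exact (PrimeSpectrum.localization_comap_injective N' 𝔮.primeCompl).eq_iff
  rw [excCurvePoints_pullback_snd_of_isPreimmersion σ _ hq hg, specMap_localization_closedPoint 𝔮]

/-- (A1), image form: the first projection maps `excCurvePoints σ_𝔮` ONTO the height-one points of `V` over `𝔮`,
injectively (`injOn_fst_excCurvePoints`). [this work] -/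
theorem image_excCurvePoints_pullback_snd_localization :
    haveI := IsLocalization.AtPrime.isLocalRing N' 𝔮
    (pullback.fst σ (Spec.map (CommRingCat.ofHom (algebraMap N N')))).base ''
        excCurvePoints (pullback.snd σ (Spec.map (CommRingCat.ofHom (algebraMap N N')))) =
      {z | σ.base z = ⟨𝔮, inferInstance⟩ ∧ Order.height z = 1} := by
  haveI := IsLocalization.AtPrime.isLocalRing N' 𝔮
  haveI : IsPreimmersion (Spec.map (CommRingCat.ofHom (algebraMap N N'))) :=
    IsPreimmersion.of_isLocalization 𝔮.primeCompl
  rw [excCurvePoints_pullback_snd_localization 𝔮 σ, Set.image_preimage_eq_inter_range, Set.inter_eq_left,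
    Scheme.Pullback.range_fst]
  rintro z ⟨hz, -⟩
  exact ⟨closedPoint N', by rw [specMap_localization_closedPoint 𝔮]; exact hz.symm⟩

end Localization

end Summit.ResolutionOfSingularities.ResolutionOfSingularities.Theorems.NoZeno.ExcCount

end
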